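import Mathlib
import HarnessLib
import Summits.HubbardSuperconductivity.HubbardSuperconductivity.Theorems.KLProgrammeKLRegimeSplitFieldStrengthSectorMoment
import Summits.HubbardSuperconductivity.HubbardSuperconductivity.Theorems.KLProgrammeKLRegimeSplitTwoLegIncrementMomentsFromPosition

/-!
# Route `KLProgramme` — ENGINE child gen 8 (stmt-HubbardSuperconductivity-20437 `KLRegimeEngineV17F2`), class #7 / (E3d): the PER-INCREMENT,
# SECTOR-PINNED, MOMENTUM-SPACE TELESCOPE for the field strength — `|z_n(k⃗) − 1| ≤ |z_0(k⃗) − 1| + 2·Σ_{j<n} Σ_{ω ∈ A_j} Mᵗ_{j,ω}`, each scale's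
# increment read with ITS OWN sector family at the pinned sector of `k⃗` (cell gate-hubbard-kl, seat hubbard-kl-k3c2-p3 g8; memo W3-CURRENCY.md §4(c))

WHY.  The class-#7 time row `|z_n(k⃗) − 1| ≤ Z·U²` (n-free `Z`) is a sum over the scales `j < n` of the contributions of the two-leg INCREMENTS
`G_{j+1} − G_j` of the flow; the per-scale decay that makes the sum n-free (BGM 2006 §3 (3.6), `sup_{ω̄}`: one external sector FIXED) is available only
when each increment is read SECTOR-PINNED with the sector family OF ITS OWN SCALE `j+1` — a plain (sector-summed) read-out pays `#O_{j+1} ≍ 2^{j+1}`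
(Thm 2.1 (2.77), F = 0 vs F = 1), and a position-space moment of the CUMULATIVE kernel filtered by the FINE scale-`n` family charges a coarse increment
the fine filter's own range `Λ_n⁻¹`.  So the read-out is a telescope IN MOMENTUM SPACE AT THE POINT `k⃗`: the field strength is affine in the Grassmann
polynomial (`fieldStrength_sub_fieldStrength_eq`: `z_{G₁}(k⃗) − z_{G₀}(k⃗) = z_{G₁−G₀}(k⃗) − 1`), each difference is bounded by
`…SplitFieldStrengthSectorMoment` applied to `G_{j+1} − G_j` with a family `F_j` (that increment's own scale, or any scale whose ball plateau contains the
point) and the label set `A_j` resolving the identity at `(±ω₀, k⃗)` (`Σ_{ω∈A_j} F_{j,ω}(±ω₀,k⃗) = 1`), and the bounds add up: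

* `fieldStrengthSpin_sub_fieldStrengthSpin_eq`, `fieldStrength_sub_fieldStrength_eq` (affinity in `G`);
* `abs_fieldStrength_sub_fieldStrength_le_of_sector_time_moment` — one increment;
* **`abs_fieldStrength_sub_one_le_telescope_of_sector_time_moments`** — any sequence `G : ℕ → HubbardGrassmann L M`, scale-dependent label types
  `Fin (N j)`, families `F j`, sets `A j`, moment bounds `Mt j ω`;
* **`abs_klFieldStrength_sub_one_le_telescope_of_sector_time_moments`** — the cell's instance `G j = klEffectiveAction … K klE0 j` (fixed frame `K`, cutoff
  ladder `Λ_j = klScale klE0 j`), any families (e.g. `F j = klAnisoFamily … K klE0 j`, `N j = sectorCount j`);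
* §5 the `hA` SUPPLIER for the cell's families: `klAnisoFamily_omega0_rev_eq` (evenness at `±ω₀`), `sum_klAnisoFamily_omega0_eq_one_of_le` (the full
  family sums to `1` at `(ω₀,k⃗)` when `√((π/β)² + e_K(k⃗)²) ≤ Λ_{j+1}`: `sum_bgmMultiplier` + `gnScaleCutoff_eq_one`), `sum_filter_klAnisoFamily_omega0_eq_one_of_le`
  (`A_j(k⃗) := {ω : F_{j,ω}(ω₀,k⃗) ≠ 0}` resolves the identity at both points), and **`abs_klFieldStrength_sub_one_le_telescope_of_deep`** — the time row
  with the resolution DISCHARGED, each increment `j+1` read with the family of a scale `s j` whose ball plateau contains the read-out point.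

With per-scale budgets `Σ_{ω∈A_j} Mt_{j,ω} ≤ C·ε_j²·2^{−j}` the right side is n-free and `O(U²)` by
`EngineV8.sum_le_of_le_epsCoupling_sq_decay` (`…EngineTwoLegBudgetDecay`).  Everything is PROVED; no definitions; nothing about the model is asserted (the
resolution of the identity and the moment bounds are hypotheses — the plateau cover of the families and the tower's sector-pinned two-leg output).
References: BGM 2006 §2.1 (2.4)–(2.5), (2.36), Thm 2.1 (2.77), §3 (3.5)–(3.6) [cite: BenfattoGiulianiMastropietro2006].
-/

noncomputable section

namespace Summit.HubbardSuperconductivity.HubbardSuperconductivity.Theorems.TwoLegFourier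

set_option linter.dupNamespace false -- summit = problem name (single-conjunct summit), D-0017

open Finset Complex
open Literature.MathematicalPhysics.QuantumLattice Literature.Probability.LatticeModels GrassmannAlgebra
open Summit.HubbardSuperconductivity.HubbardSuperconductivity.Theorems.KLRegimeSplit

variable {L M : ℕ}

/-! ## §1 The field strength is affine in the Grassmann polynomial -/

/-- `z_{G₁}(k⃗,σ) − z_{G₀}(k⃗,σ) = z_{G₁−G₀}(k⃗,σ) − 1`. -/
theorem fieldStrengthSpin_sub_fieldStrengthSpin_eq [NeZero L] [NeZero M] (β : ℝ) (G₁ G₀ : HubbardGrassmann L M) (k : TorusSite 2 L) (σ : Fin 2) :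
    fieldStrengthSpin L M β G₁ k σ - fieldStrengthSpin L M β G₀ k σ = fieldStrengthSpin L M β (G₁ - G₀) k σ - 1 := by
  simp only [fieldStrengthSpin, selfEnergy_sub, Complex.sub_im]
  ring

/-- `z_{G₁}(k⃗) − z_{G₀}(k⃗) = z_{G₁−G₀}(k⃗) − 1`. -/
theorem fieldStrength_sub_fieldStrength_eq [NeZero L] [NeZero M] (β : ℝ) (G₁ G₀ : HubbardGrassmann L M) (k : TorusSite 2 L) :
    fieldStrength L M β G₁ k - fieldStrength L M β G₀ k = fieldStrength L M β (G₁ - G₀) k - 1 := by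
  simp only [fieldStrength]
  have h0 := fieldStrengthSpin_sub_fieldStrengthSpin_eq β G₁ G₀ k 0
  have h1 := fieldStrengthSpin_sub_fieldStrengthSpin_eq β G₁ G₀ k 1
  linarith

/-! ## §2 One increment, sector-pinned -/

/-- **ONE INCREMENT**: if the scale family `F` resolves the identity on `A` at `(±ω₀, k⃗)` and the `F`-sectorised two-leg kernel of the DIFFERENCE
`G₁ − G₀`, leg `0` pinned at `(x₀, ω)` (`ω ∈ A`), leg `1` summed over positions and `ω' ∈ A`, has temporal first moment `≤ Mt ω` (both spins, every `x₀`),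
then `|z_{G₁}(k⃗) − z_{G₀}(k⃗)| ≤ 2·Σ_{ω∈A} Mt ω`. [cite: BenfattoGiulianiMastropietro2006, §3 (3.5)–(3.6)] -/
theorem abs_fieldStrength_sub_fieldStrength_le_of_sector_time_moment [NeZero L] [NeZero M] {N : ℕ} {β : ℝ} (hβ : 0 < β)
    (F : Fin N → FreqMomentum L M → ℂ) (G₁ G₀ : HubbardGrassmann L M) (k : TorusSite 2 L) {A : Finset (Fin N)}
    (hA : ∑ ω ∈ A, F ω (omega0 M, k) = 1) (hA' : ∑ ω ∈ A, F ω ((omega0 M).rev, k) = 1) {Mt : Fin N → ℝ}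
    (hMt : ∀ (σ : Fin 2), ∀ ω ∈ A, ∀ x₀ : SpaceTimeIdx L M, imagTimeWeight β M *
      ∑ x ∈ (univ : Finset (Fin 2 → SpaceTimeIdx L M)).filter (fun x => x 0 = x₀), ∑ ω' ∈ A,
        imagTimeWeight β M * (circDist (2 * M) (x 0).1.val (x 1).1.val : ℝ) *
          ‖sectorisedKernel L M β F (G₁ - G₀) 2 (![((ω, σ), 0), ((ω', σ), 1)] : Fin 2 → SectorLeg N) x‖ ≤ Mt ω) :
    |fieldStrength L M β G₁ k - fieldStrength L M β G₀ k| ≤ 2 * ∑ ω ∈ A, Mt ω := by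
  rw [fieldStrength_sub_fieldStrength_eq]
  exact abs_fieldStrength_sub_one_le_of_sector_time_moment hβ F (G₁ - G₀) k hA hA' hMt

/-! ## §3 The telescope over the scales -/

/-- **THE PER-INCREMENT SECTOR-PINNED TELESCOPE** (generic): for a sequence `G : ℕ → HubbardGrassmann L M`, scale-dependent label types `Fin (N j)`,
families `F j` and label sets `A j` resolving the identity at `(±ω₀,k⃗)` (`j < n`; `F j` is the family with which the `j`-th increment `G (j+1) − G j`
is read — the family of that increment's own scale, or of any scale whose ball plateau contains the read-out point), and sector-pinned temporal
first-moment bounds `Mt j ω` for the `F j`-sectorised two-leg kernels of the increments, one has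
`|z_{G n}(k⃗) − 1| ≤ |z_{G 0}(k⃗) − 1| + 2·Σ_{j<n} Σ_{ω∈A j} Mt j ω`. [cite: BenfattoGiulianiMastropietro2006, (2.36), §3 (3.6)] -/
theorem abs_fieldStrength_sub_one_le_telescope_of_sector_time_moments [NeZero L] [NeZero M] {β : ℝ} (hβ : 0 < β)
    (G : ℕ → HubbardGrassmann L M) {N : ℕ → ℕ} (F : ∀ j, Fin (N j) → FreqMomentum L M → ℂ) (A : ∀ j, Finset (Fin (N j)))
    (k : TorusSite 2 L) {n : ℕ}
    (hA : ∀ j < n, ∑ ω ∈ A j, F j ω (omega0 M, k) = 1) (hA' : ∀ j < n, ∑ ω ∈ A j, F j ω ((omega0 M).rev, k) = 1)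
    {Mt : ∀ j, Fin (N j) → ℝ}
    (hMt : ∀ j < n, ∀ (σ : Fin 2), ∀ ω ∈ A j, ∀ x₀ : SpaceTimeIdx L M, imagTimeWeight β M *
      ∑ x ∈ (univ : Finset (Fin 2 → SpaceTimeIdx L M)).filter (fun x => x 0 = x₀), ∑ ω' ∈ A j,
        imagTimeWeight β M * (circDist (2 * M) (x 0).1.val (x 1).1.val : ℝ) *
          ‖sectorisedKernel L M β (F j) (G (j + 1) - G j) 2 (![((ω, σ), 0), ((ω', σ), 1)] : Fin 2 → SectorLeg (N j)) x‖ ≤ Mt j ω) :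
    |fieldStrength L M β (G n) k - 1| ≤ |fieldStrength L M β (G 0) k - 1| + 2 * ∑ j ∈ range n, ∑ ω ∈ A j, Mt j ω := by
  induction n with
  | zero => simp
  | succ n ih =>
    have hstep := abs_fieldStrength_sub_fieldStrength_le_of_sector_time_moment hβ (F n) (G (n + 1)) (G n) k
      (hA n (Nat.lt_succ_self n)) (hA' n (Nat.lt_succ_self n)) (hMt n (Nat.lt_succ_self n))
    have hih := ih (fun j hj => hA j (Nat.lt_succ_of_lt hj)) (fun j hj => hA' j (Nat.lt_succ_of_lt hj))
      (fun j hj => hMt j (Nat.lt_succ_of_lt hj))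
    have htri : |fieldStrength L M β (G (n + 1)) k - 1| ≤
        |fieldStrength L M β (G (n + 1)) k - fieldStrength L M β (G n) k| + |fieldStrength L M β (G n) k - 1| := by
      have := abs_sub_le (fieldStrength L M β (G (n + 1)) k) (fieldStrength L M β (G n) k) 1
      simpa only [sub_eq_add_neg] using this
    rw [sum_range_succ, mul_add]
    linarith

/-! ## §4 The cell's instance: the cutoff ladder at a fixed frame -/

section Model

open Summit.HubbardSuperconductivity.HubbardSuperconductivity.Theorems.KLProgrammeLegKernels

/-- **THE TIME ROW OF CLASS #7 IN SECTOR-PINNED, PER-INCREMENT CURRENCY** — for the scale-`j` actions `G j = klEffectiveAction … K klE0 j` at a FIXED frame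
`K` (any families `F j` on `Fin (N j)`, e.g. `klAnisoFamily … K klE0 (j+1)` on `Fin (sectorCount (j+1))` for the increment born at scale `j+1`): if for `j < n`
the family `F j` resolves the identity on `A j` at `(±ω₀,k⃗)` and the `F j`-sectorised two-leg kernel of the increment `G (j+1) − G j`, leg `0` pinned at
`(x₀, ω)`, `ω ∈ A j`, has temporal first moment `≤ Mt j ω`, then `|z_n(K)(k⃗) − 1| ≤ |z_0(K)(k⃗) − 1| + 2·Σ_{j<n} Σ_{ω∈A j} Mt j ω` — with
`Σ_ω Mt j ω ≤ C·ε_{j}²·2^{−j}` the sum is `≤ 12·C·Klam²·U²` uniformly in `n` (`EngineV8.sum_le_of_le_epsCoupling_sq_decay`). -/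
theorem abs_klFieldStrength_sub_one_le_telescope_of_sector_time_moments [NeZero L] [NeZero M] {β : ℝ} (hβ : 0 < β) (U μ : ℝ)
    (K : TrigPolyC4v) {N : ℕ → ℕ} (F : ∀ j, Fin (N j) → FreqMomentum L M → ℂ) (A : ∀ j, Finset (Fin (N j))) (k : TorusSite 2 L) {n : ℕ}
    (hA : ∀ j < n, ∑ ω ∈ A j, F j ω (omega0 M, k) = 1) (hA' : ∀ j < n, ∑ ω ∈ A j, F j ω ((omega0 M).rev, k) = 1)
    {Mt : ∀ j, Fin (N j) → ℝ}
    (hMt : ∀ j < n, ∀ (σ : Fin 2), ∀ ω ∈ A j, ∀ x₀ : SpaceTimeIdx L M, imagTimeWeight β M *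
      ∑ x ∈ (univ : Finset (Fin 2 → SpaceTimeIdx L M)).filter (fun x => x 0 = x₀), ∑ ω' ∈ A j,
        imagTimeWeight β M * (circDist (2 * M) (x 0).1.val (x 1).1.val : ℝ) *
          ‖sectorisedKernel L M β (F j)
              (klEffectiveAction L M β U μ K klE0 (j + 1) - klEffectiveAction L M β U μ K klE0 j) 2
              (![((ω, σ), 0), ((ω', σ), 1)] : Fin 2 → SectorLeg (N j)) x‖ ≤ Mt j ω) :
    |klFieldStrength L M β U μ K n k - 1| ≤ |klFieldStrength L M β U μ K 0 k - 1| + 2 * ∑ j ∈ range n, ∑ ω ∈ A j, Mt j ω :=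
  abs_fieldStrength_sub_one_le_telescope_of_sector_time_moments hβ (fun j => klEffectiveAction L M β U μ K klE0 j) F A k hA hA' hMt

end Model


/-! ## §5 The cell's anisotropic families resolve the identity at deep momenta (the `hA` supplier) -/

section Resolution

open Summit.HubbardSuperconductivity.HubbardSuperconductivity.Theorems.KLProgrammeLegKernels

/-- **Evenness at the two read-out frequencies**: `F_{j,ω}(−ω₀, k⃗) = F_{j,ω}(ω₀, k⃗)` — the anisotropic multiplier depends on the frequency only
through its square. -/
theorem klAnisoFamily_omega0_rev_eq [NeZero L] [NeZero M] (β μ : ℝ) (K : TrigPolyC4v) (e₀ : ℝ) (j : ℕ) (ω : Fin (sectorCount j))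
    (k : TorusSite 2 L) :
    klAnisoFamily L M β μ K e₀ j ω ((omega0 M).rev, k) = klAnisoFamily L M β μ K e₀ j ω (omega0 M, k) := by
  simp only [klAnisoFamily, bgmMultiplier, matsubaraFreq_omega0, matsubaraFreq_omega0_rev, neg_sq]

/-- **The full family sums to one at a deep momentum**: if `√((π/β)² + e_K(k⃗)²) ≤ Λ_{j+1}` (`Λ_m = klScale klE0 m`; the point `(±ω₀, k⃗)` lies in the
plateau of the ball cutoff `C_{−j}⁻¹` of the fields of scales `≤ −j`), then `Σ_ω F_{j,ω}(ω₀, k⃗) = 1`. [cite: BenfattoGiulianiMastropietro2006, §2.3 (2.19), §2.5 (2.45)] -/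
theorem sum_klAnisoFamily_omega0_eq_one_of_le [NeZero L] [NeZero M] (β μ : ℝ) (K : TrigPolyC4v) (j : ℕ) (k : TorusSite 2 L)
    (hdeep : Real.sqrt ((Real.pi / β) ^ 2 + nambuXiCT L μ K k ^ 2) ≤ klScale klE0 (j + 1)) :
    ∑ ω : Fin (sectorCount j), klAnisoFamily L M β μ K klE0 j ω (omega0 M, k) = 1 := by
  have hsum := sum_bgmMultiplier (L := L) (M := M) klE0 β (nambuXiCT L μ K) j (omega0 M, k)
  simp only [klAnisoFamily]
  rw [hsum, matsubaraFreq_omega0]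
  have h4 : (4 : ℝ) ^ (-(j : ℤ) - 1) = ((4 : ℝ) ^ (j + 1))⁻¹ := by
    rw [show (-(j : ℤ) - 1) = -((j + 1 : ℕ) : ℤ) by push_cast; ring, zpow_neg, zpow_natCast]
  have ht : Real.sqrt ((Real.pi / β) ^ 2 + nambuXiCT L μ K k ^ 2) ≤ klE0 * (4 : ℝ) ^ (-(j : ℤ) - 1) := by
    rw [h4]; simpa only [klScale] using hdeep
  rw [gnScaleCutoff_eq_one (by norm_num : (1 : ℝ) < 4) (by norm_num [klE0] : (0 : ℝ) < klE0) ht, Complex.ofReal_one]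

/-- **THE `hA` SUPPLIER**: at a deep momentum the label set `A_j(k⃗) := {ω : F_{j,ω}(ω₀,k⃗) ≠ 0}` (the two or three angular sectors around the angle of `k⃗`)
resolves the identity at BOTH read-out points: `Σ_{ω∈A_j(k⃗)} F_{j,ω}(ω₀,k⃗) = 1 = Σ_{ω∈A_j(k⃗)} F_{j,ω}(−ω₀,k⃗)`. -/
theorem sum_filter_klAnisoFamily_omega0_eq_one_of_le [NeZero L] [NeZero M] (β μ : ℝ) (K : TrigPolyC4v) (j : ℕ) (k : TorusSite 2 L)
    (hdeep : Real.sqrt ((Real.pi / β) ^ 2 + nambuXiCT L μ K k ^ 2) ≤ klScale klE0 (j + 1)) :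
    (∑ ω ∈ univ.filter (fun ω : Fin (sectorCount j) => klAnisoFamily L M β μ K klE0 j ω (omega0 M, k) ≠ 0),
        klAnisoFamily L M β μ K klE0 j ω (omega0 M, k) = 1) ∧
      (∑ ω ∈ univ.filter (fun ω : Fin (sectorCount j) => klAnisoFamily L M β μ K klE0 j ω (omega0 M, k) ≠ 0),
        klAnisoFamily L M β μ K klE0 j ω ((omega0 M).rev, k) = 1) := by
  have h1 := sum_klAnisoFamily_omega0_eq_one_of_le (L := L) (M := M) β μ K j k hdeep
  refine ⟨by rwa [sum_filter_ne_zero], ?_⟩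
  simp only [klAnisoFamily_omega0_rev_eq]
  rwa [sum_filter_ne_zero]

/-- **THE TIME ROW, CELL INSTANCE WITH THE RESOLUTION DISCHARGED**: read the `j`-th increment `𝒱^{(j+1)}[K] − 𝒱^{(j)}[K]` (`j < n`) with the anisotropic
family of some scale `s j` whose ball plateau contains the read-out point, `√((π/β)² + e_K(k⃗)²) ≤ Λ_{s j + 1}` (e.g. `s j = j+1`, the increment's own scale, when
`j + 3 ≤ n` and `π/β ≤ Λ_n`; `s j = n − 2` for the last two increments), pin leg `0` at the sectors `A_{s j}(k⃗) = {ω : F_{s j,ω}(ω₀,k⃗) ≠ 0}`: then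
`|z_n(K)(k⃗) − 1| ≤ |z_0(K)(k⃗) − 1| + 2·Σ_{j<n} Σ_{ω∈A_{s j}(k⃗)} Mt j ω`. -/
theorem abs_klFieldStrength_sub_one_le_telescope_of_deep [NeZero L] [NeZero M] {β : ℝ} (hβ : 0 < β) (U μ : ℝ) (K : TrigPolyC4v)
    (k : TorusSite 2 L) {n : ℕ} (s : ℕ → ℕ)
    (hdeep : ∀ j < n, Real.sqrt ((Real.pi / β) ^ 2 + nambuXiCT L μ K k ^ 2) ≤ klScale klE0 (s j + 1))
    {Mt : ∀ j : ℕ, Fin (sectorCount (s j)) → ℝ}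
    (hMt : ∀ j < n, ∀ (σ : Fin 2),
      ∀ ω ∈ univ.filter (fun ω : Fin (sectorCount (s j)) => klAnisoFamily L M β μ K klE0 (s j) ω (omega0 M, k) ≠ 0),
      ∀ x₀ : SpaceTimeIdx L M, imagTimeWeight β M *
      ∑ x ∈ (univ : Finset (Fin 2 → SpaceTimeIdx L M)).filter (fun x => x 0 = x₀),
        ∑ ω' ∈ univ.filter (fun ω : Fin (sectorCount (s j)) => klAnisoFamily L M β μ K klE0 (s j) ω (omega0 M, k) ≠ 0),
        imagTimeWeight β M * (circDist (2 * M) (x 0).1.val (x 1).1.val : ℝ) *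
          ‖sectorisedKernel L M β (klAnisoFamily L M β μ K klE0 (s j))
              (klEffectiveAction L M β U μ K klE0 (j + 1) - klEffectiveAction L M β U μ K klE0 j) 2
              (![((ω, σ), 0), ((ω', σ), 1)] : Fin 2 → SectorLeg (sectorCount (s j))) x‖ ≤ Mt j ω) :
    |klFieldStrength L M β U μ K n k - 1| ≤ |klFieldStrength L M β U μ K 0 k - 1| +
      2 * ∑ j ∈ range n, ∑ ω ∈ univ.filter (fun ω : Fin (sectorCount (s j)) => klAnisoFamily L M β μ K klE0 (s j) ω (omega0 M, k) ≠ 0),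
        Mt j ω :=
  abs_klFieldStrength_sub_one_le_telescope_of_sector_time_moments hβ U μ K (N := fun j => sectorCount (s j))
    (fun j => klAnisoFamily L M β μ K klE0 (s j))
    (fun j => univ.filter (fun ω : Fin (sectorCount (s j)) => klAnisoFamily L M β μ K klE0 (s j) ω (omega0 M, k) ≠ 0)) k
    (fun j hj => (sum_filter_klAnisoFamily_omega0_eq_one_of_le β μ K (s j) k (hdeep j hj)).1)
    (fun j hj => (sum_filter_klAnisoFamily_omega0_eq_one_of_le β μ K (s j) k (hdeep j hj)).2) hMt

end Resolution

end Summit.HubbardSuperconductivity.HubbardSuperconductivity.Theorems.TwoLegFourier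

end
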